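import Summits.CriticalPhenomena.Ising3DConformalLimit.Theorems.PrecisionLaplacianDirectCorrelationStableTailSlabModeExpDecayDiagLineHolAux9
import Summits.CriticalPhenomena.Ising3DConformalLimit.Theorems.PrecisionLaplacianDirectCorrelationStableTailSlabModeExpDecayDiagLineHolAux6

/-!
# Diagonal line holomorphy, auxiliary file 10: boundary momenta and the abstract diagonal line holomorphy

Helper file for the sub-stub `stub_slabModeExpDecay_auxDiagLineHol` (brick of `stub_slabModeExpDecay`)
of line `self-energy-pick-inversion`, crux `PrecisionLaplacian.DirectCorrelationStableTail`
(stmt-CriticalPhenomena-4799). Pure theorem file.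

* `lineMoments_of_reduced` (registered sub-goal `stub_slabModeExpDecay_auxDiagLineHol10`): the moment
  representation of file 6 extends from the open reduced zone to every nonzero `κ ∈ [-π,π]²` (weak
  limits along `(1 - 1/(j+2))κ`, moment criterion of file 2);
* `lineHol_diag_of_stepLaw` : the line holomorphy along a diagonal frame for an abstract even
  sub-stochastic, hyperoctahedrally invariant step law with the unified diagonal moment property
  (reduction to the frame `e₀ + e₁` and a reduced transverse momentum by file 9, moments by
  `lineMoments_of_reduced`, extension and bounds by file 9).
-/

noncomputable section

namespace Summit.CriticalPhenomena.Ising3DConformalLimit.Cruxes.DirectCorrelationStableTail.SelfEnergyPickInversion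

open MeasureTheory Filter Topology Finset Real Literature.Probability.LatticeModels
open scoped BigOperators

variable {q : Site 3 → ℝ} {P : ℕ → Site 3 → ℝ}

/-! ### Boundary momenta by weak limits -/

/-- **The moment representation at every nonzero reduced momentum** `κ ∈ [-π,π]² ∖ {0}` (limits of
the representation of file 6 along `(1 - 1/(j+2))κ`). [folklore] -/
theorem lineMoments_of_reduced (hq0 : ∀ y, 0 ≤ q y) (hqs : Summable q) (hq1 : ∑' y, q y ≤ 1)
    (hqev : ∀ y, q (-y) = q y) (hqsym : ∀ x : Site 3, q ![x 1, x 0, -(x 2)] = q x)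
    (hP0 : ∀ z, P 0 z = if z = 0 then 1 else 0) (hPs : ∀ j z, P (j + 1) z = ∑' y, q y * P j (z - y))
    {G : Site 3 → ℝ} (hGreen : ∀ z, HasSum (fun j => P j z) (G z)) (hGpos : ∀ m : Fin 3, 0 < G (Pi.single m 1))
    (hGev : ∀ x, G (-x) = G x) (hGsym : ∀ x : Site 3, G ![x 1, x 0, -(x 2)] = G x)
    (hT : ∀ (s : Finset (Fin 2 → ℤ)) (c : (Fin 2 → ℤ) → ℝ), ∃ ν : Measure ℝ, IsFiniteMeasure ν ∧
      ν (Set.Icc (-1 : ℝ) 1)ᶜ = 0 ∧ ∀ n : ℕ,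
        (∑ a ∈ s, ∑ b ∈ s, c a * c b * G ![(a 0 - b 0) + n, -(a 0 - b 0) + n, a 1 - b 1] = ∫ x, x ^ (2 * n) ∂ν) ∧
        (∑ a ∈ s, ∑ b ∈ s, c a * c b * G ![n + 1 - a 0 - b 0, n + a 0 + b 0, -(a 1) - b 1] = ∫ x, x ^ (2 * n + 1) ∂ν))
    {κ : Fin 2 → ℝ} (hκ : ∀ j, |κ j| ≤ π) (hne : ∃ j, κ j ≠ 0) :
    ∃ ν : Measure ℝ, IsFiniteMeasure ν ∧ ν (Set.Icc (-1 : ℝ) 1)ᶜ = 0 ∧ ∀ m : ℕ,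
      ∫ θ in (-π)..π, Real.cos (m * θ) * (1 - ∑' x : Site 3,
        q x * Real.cos (phase 3 ![θ + κ 0 / 2, θ - κ 0 / 2, κ 1] x))⁻¹ = ∫ x, x ^ m ∂ν := by
  have hπ := Real.pi_pos
  obtain ⟨j₀, hj₀⟩ := hne
  -- the approximating good momenta
  set r : ℕ → ℝ := fun j => 1 - 1 / ((j : ℝ) + 2) with hr
  have hr0 : ∀ j, 0 < r j := fun j => by
    simp only [hr]; have : 1 / ((j : ℝ) + 2) ≤ 1 / 2 := by
      rw [div_le_div_iff₀ (by positivity) (by positivity)]; linarith [(Nat.cast_nonneg j : (0 : ℝ) ≤ j)]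
    linarith
  have hr1 : ∀ j, r j < 1 := fun j => by
    simp only [hr]; have : (0 : ℝ) < 1 / ((j : ℝ) + 2) := by positivity
    linarith
  have hrlim : Tendsto r atTop (𝓝 1) := by
    have h : Tendsto (fun j : ℕ => 1 / ((j : ℝ) + 2)) atTop (𝓝 0) :=
      tendsto_const_nhds.div_atTop (tendsto_atTop_add_const_right _ _ tendsto_natCast_atTop_atTop)
    simpa [hr] using tendsto_const_nhds.sub h
  set κs : ℕ → Fin 2 → ℝ := fun j => r j • κ with hκs
  have hκs_lt : ∀ j l, |κs j l| < π := fun j l => by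
    simp only [hκs, Pi.smul_apply, smul_eq_mul, abs_mul, abs_of_pos (hr0 j)]
    rcases (abs_nonneg (κ l)).eq_or_lt with h0 | h0
    · rw [← h0, mul_zero]; exact hπ
    · calc r j * |κ l| < 1 * |κ l| := mul_lt_mul_of_pos_right (hr1 j) h0
        _ ≤ π := by rw [one_mul]; exact hκ l
  have hκs_ne : ∀ j, ∃ l, κs j l ≠ 0 := fun j =>
    ⟨j₀, by simp only [hκs, Pi.smul_apply, smul_eq_mul]; exact mul_ne_zero (hr0 j).ne' hj₀⟩
  have hκs_lim : Tendsto κs atTop (𝓝 κ) := by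
    have := hrlim.smul_const κ
    rwa [one_smul] at this
  -- the measures at the good momenta
  have hex : ∀ j, ∃ ν : Measure ℝ, IsFiniteMeasure ν ∧ ν (Set.Icc (-1 : ℝ) 1)ᶜ = 0 ∧ ∀ m : ℕ,
      ∫ θ in (-π)..π, Real.cos (m * θ) * (1 - ∑' x : Site 3,
        q x * Real.cos (phase 3 ![θ + κs j 0 / 2, θ - κs j 0 / 2, κs j 1] x))⁻¹ = ∫ x, x ^ m ∂ν := fun j =>
    lineMoments_of_good hq0 hqs hq1 hqev hqsym hP0 hPs hGreen hGpos hGev hGsym hT (hκs_lt j) (hκs_ne j)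
  choose ν hνfin hν0 hνmom using hex
  -- continuity of the transforms at `κ` (which is off `(2πℤ)²`)
  have hgood : ∃ l, ∀ z : ℤ, κ l ≠ z * (2 * π) := by
    refine ⟨j₀, fun z hz => ?_⟩
    have h1 : |(z : ℝ)| * (2 * π) ≤ π := by
      have := hκ j₀; rw [hz, abs_mul, abs_of_pos Real.two_pi_pos] at this; exact this
    have h2 : |(z : ℝ)| < 1 := by nlinarith [abs_nonneg (z : ℝ)]
    have h3 : z = 0 := by
      have : |z| < 1 := by exact_mod_cast h2
      exact Int.abs_lt_one_iff.mp this
    subst h3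
    exact hj₀ (by simpa using hz)
  set cT : ℕ → (Fin 2 → ℝ) → ℝ := fun m k => ∫ θ in (-π)..π, Real.cos (m * θ) * (1 - ∑' x : Site 3,
    q x * Real.cos (phase 3 ![θ + k 0 / 2, θ - k 0 / 2, k 1] x))⁻¹ with hcT
  have hlim : ∀ m, Tendsto (fun j => ∫ x, x ^ m ∂(ν j)) atTop (𝓝 (cT m κ)) := by
    intro m
    have h1 : Tendsto (fun j => cT m (κs j)) atTop (𝓝 (cT m κ)) :=
      (continuousAt_lineTransform hq0 hqs hq1 hP0 hPs hGreen hGpos hgood m).tendsto.comp hκs_lim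
    refine h1.congr fun j => ?_
    exact hνmom j m
  -- bounded masses
  obtain ⟨M, hM⟩ := (hlim 0).bddAbove_range
  have hle : ∀ j n, n ≤ j → ∫ x, x ^ (2 * n) ∂(ν j) ≤ M := fun j n _ => by
    haveI := hνfin j
    exact (integrable_pow_of_Icc_neg_one (hν0 j) n).2.trans (hM ⟨j, rfl⟩)
  obtain ⟨μ, hμfin, hμ0, hμmom⟩ := exists_measure_Icc_neg_one_of_momentLimit (fun m => cT m κ) ν hνfin
    (fun j m => by haveI := hνfin j; exact (integrable_pow_of_Icc_neg_one (hν0 j) m).1) hle hlim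
  exact ⟨μ, hμfin, hμ0, fun m => hμmom m⟩

/-- **Registered auxiliary stub `stub_slabModeExpDecay_auxDiagLineHol10`** (sub-goal of the brick
`stub_slabModeExpDecay_auxDiagLineHol` of `stub_slabModeExpDecay`): the moment representation at every
nonzero reduced transverse momentum (`lineMoments_of_reduced`). [folklore] -/
theorem stub_slabModeExpDecay_auxDiagLineHol10 : ∀ (q : Site 3 → ℝ) (P : ℕ → Site 3 → ℝ) (G : Site 3 → ℝ), (∀ y, 0 ≤ q y) → Summable q → ∑' y, q y ≤ 1 → (∀ y, q (-y) = q y) → (∀ x : Site 3, q ![x 1, x 0, -(x 2)] = q x) → (∀ z, P 0 z = if z = 0 then 1 else 0) → (∀ j z, P (j + 1) z = ∑' y, q y * P j (z - y)) → (∀ z, HasSum (fun j => P j z) (G z)) → (∀ m : Fin 3, 0 < G (Pi.single m 1)) → (∀ x, G (-x) = G x) → (∀ x : Site 3, G ![x 1, x 0, -(x 2)] = G x) → (∀ (s : Finset (Fin 2 → ℤ)) (c : (Fin 2 → ℤ) → ℝ), ∃ ν : MeasureTheory.Measure ℝ, MeasureTheory.IsFiniteMeasure ν ∧ ν (Set.Icc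 (-1 : ℝ) 1)ᶜ = 0 ∧ ∀ n : ℕ, (∑ a ∈ s, ∑ b ∈ s, c a * c b * G ![(a 0 - b 0) + n, -(a 0 - b 0) + n, a 1 - b 1] = ∫ x, x ^ (2 * n) ∂ν) ∧ (∑ a ∈ s, ∑ b ∈ s, c a * c b * G ![n + 1 - a 0 - b 0, n + a 0 + b 0, -(a 1) - b 1] = ∫ x, x ^ (2 * n + 1) ∂ν)) → ∀ (κ₀ : Fin 2 → ℝ), (∀ j, |κ₀ j| ≤ Real.pi) → (∃ j, κ₀ j ≠ 0) → ∃ ν : MeasureTheory.Measure ℝ, MeasureTheory.IsFiniteMeasure ν ∧ ν (Set.Icc (-1 : ℝ) 1)ᶜ = 0 ∧ ∀ m : ℕ, ∫ θ in (-Real.pi)..Real.pi, Real.cos (m * θ) * (1 - ∑' x : Site 3, q x * Real.cos (phase 3 ![θ + κ₀ 0 / 2, θ - κ₀ 0 / 2, κ₀ 1] x))⁻¹ = ∫ x, x ^ m ∂ν :=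
  fun _ _ _ hq0 hqs hq1 hqev hqsym hP0 hPs hGreen hGpos hGev hGsym hT _ hκ hne =>
    lineMoments_of_reduced hq0 hqs hq1 hqev hqsym hP0 hPs hGreen hGpos hGev hGsym hT hκ hne

/-! ### The abstract line holomorphy along a diagonal frame -/

/-- **Line holomorphy along a diagonal frame, abstract form.** For an even sub-stochastic step law `q`
on `ℤ³`, hyperoctahedrally invariant, with Green function `G` positive at the unit vectors, even,
invariant under `x ↦ (x₁, x₀, -x₂)` and having the unified diagonal moment property, and with the Green
symbol function bounded by `C` at sup-distance `≥ m` from `(2πℤ)³`: along every diagonal frame line with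
`dist(p·u, 2πℤ) ≥ d` and margin `≥ m`, `s ↦ g(p + s u/2)` extends holomorphically to the disc
`|z| < d/2` with the bound `C/sin²(d/4)`. [folklore] -/
theorem lineHol_diag_of_stepLaw {q : Site 3 → ℝ} {P : ℕ → Site 3 → ℝ} (hq0 : ∀ y, 0 ≤ q y) (hqs : Summable q)
    (hq1 : ∑' y, q y ≤ 1) (hqev : ∀ y, q (-y) = q y) (hqsym : ∀ x : Site 3, q ![x 1, x 0, -(x 2)] = q x)
    (hqsp : ∀ (σ : Equiv.Perm (Fin 3)) (ε : Fin 3 → ℤ), (∀ l, ε l = 1 ∨ ε l = -1) →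
      ∀ x : Site 3, q (fun i => ε (σ.symm i) * x (σ.symm i)) = q x)
    (hP0 : ∀ z, P 0 z = if z = 0 then 1 else 0) (hPs : ∀ j z, P (j + 1) z = ∑' y, q y * P j (z - y))
    {G : Site 3 → ℝ} (hGreen : ∀ z, HasSum (fun j => P j z) (G z)) (hGpos : ∀ m : Fin 3, 0 < G (Pi.single m 1))
    (hGev : ∀ x, G (-x) = G x) (hGsym : ∀ x : Site 3, G ![x 1, x 0, -(x 2)] = G x)
    (hT : ∀ (s : Finset (Fin 2 → ℤ)) (c : (Fin 2 → ℤ) → ℝ), ∃ ν : Measure ℝ, IsFiniteMeasure ν ∧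
      ν (Set.Icc (-1 : ℝ) 1)ᶜ = 0 ∧ ∀ n : ℕ,
        (∑ a ∈ s, ∑ b ∈ s, c a * c b * G ![(a 0 - b 0) + n, -(a 0 - b 0) + n, a 1 - b 1] = ∫ x, x ^ (2 * n) ∂ν) ∧
        (∑ a ∈ s, ∑ b ∈ s, c a * c b * G ![n + 1 - a 0 - b 0, n + a 0 + b 0, -(a 1) - b 1] = ∫ x, x ^ (2 * n + 1) ∂ν))
    {d m C : ℝ} (hd : 0 < d) (hm : 0 < m)
    (hC : ∀ ξ : Fin 3 → ℝ, (∀ L : Fin 3 → ℤ, m ≤ ‖fun j => ξ j - 2 * π * L j‖) →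
      0 < 1 - ∑' x : Site 3, q x * Real.cos (phase 3 ξ x) ∧ (1 - ∑' x : Site 3, q x * Real.cos (phase 3 ξ x))⁻¹ ≤ C)
    {u : Site 3} (hu : ∃ i j : Fin 3, i ≠ j ∧ (u = Pi.single i 1 + Pi.single j 1 ∨ u = Pi.single i 1 - Pi.single j 1))
    {p : Fin 3 → ℝ} (hpd : ∀ n : ℤ, d ≤ |(∑ j, p j * (u j : ℝ)) - 2 * π * n|)
    (hpm : ∀ (t : ℝ) (L : Fin 3 → ℤ), m ≤ ‖(fun j => p j + t * ((u j : ℝ) / ∑ l, ((u l : ℝ)) ^ 2) - 2 * π * (L j : ℝ))‖) :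
    ∃ F : ℂ → ℂ, DifferentiableOn ℂ F (Metric.ball (0 : ℂ) (1 / 2 * d)) ∧
      (∀ s : ℝ, |s| < 1 / 2 * d → F (s : ℂ) = (((1 - ∑' x : Site 3, q x *
        Real.cos (phase 3 (fun j => p j + s * ((u j : ℝ) / ∑ l, ((u l : ℝ)) ^ 2)) x))⁻¹ : ℝ) : ℂ)) ∧
      (∀ z : ℂ, ‖z‖ < 1 / 2 * d → ‖F z‖ ≤ 2 * π * C / (2 * π * Real.sin (d / 4) ^ 2)) := by
  have hπ := Real.pi_pos
  have hε2_of : ∀ {ε : Fin 3 → ℤ}, (∀ l, ε l = 1 ∨ ε l = -1) → ∀ l, (ε l : ℝ) * ε l = 1 := fun hε l => by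
    rcases hε l with h | h <;> simp [h]
  -- ### reduction to the frame `e₀ + e₁` and to a reduced transverse momentum
  obtain ⟨σ, ε, hε, hεu⟩ := exists_signedPerm_of_diagFrame hu
  have hε2 : ∀ l, (ε l : ℝ) * ε l = 1 := hε2_of hε
  have huσ : ∀ l, (u (σ l) : ℝ) = ε l * (![1, 1, 0] : Fin 3 → ℝ) l := fun l => by
    have h := hεu l
    have h' : (ε l : ℝ) * (u (σ l) : ℝ) = ((![1, 1, 0] : Fin 3 → ℤ) l : ℝ) := by exact_mod_cast h
    calc (u (σ l) : ℝ) = (ε l * ε l) * (u (σ l) : ℝ) := by rw [hε2, one_mul]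
      _ = ε l * ((![1, 1, 0] : Fin 3 → ℤ) l : ℝ) := by rw [mul_assoc, h']
      _ = _ := by congr 1; fin_cases l <;> simp
  have hε2' : ∀ l, (ε l : ℝ) ^ 2 = 1 := fun l => by rw [sq, hε2]
  have hu2 : ∑ l, ((u l : ℝ)) ^ 2 = 2 := by
    rw [← Equiv.sum_comp σ (fun l => ((u l : ℝ)) ^ 2)]
    simp only [huσ, mul_pow, Fin.sum_univ_three]
    simp [hε2']; norm_num
  set p' : Fin 3 → ℝ := fun l => ε l * p (σ l) with hp'
  have hpu : ∑ l, p l * (u l : ℝ) = p' 0 + p' 1 := by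
    rw [← Equiv.sum_comp σ (fun l => p l * (u l : ℝ))]
    simp only [huσ, hp', Fin.sum_univ_three]
    simp; ring
  obtain ⟨L, hL01, hL2⟩ := exists_lattice_shift_reduced p'
  set p'' : Fin 3 → ℝ := fun l => p' l - 2 * π * L l with hp''
  set κ : Fin 2 → ℝ := ![p'' 0 - p'' 1, p'' 2] with hκ
  set θ₀ : ℝ := (p'' 0 + p'' 1) / 2 with hθ₀
  have hκle : ∀ j, |κ j| ≤ π := fun j => by fin_cases j <;> simp [hκ, hp''] <;> assumption
  -- the line points: `p + t u/2 ↦ p'' + t (e₀+e₁)/2 = (θ₀ + t/2 + κ₀/2, θ₀ + t/2 - κ₀/2, κ₁)`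
  have hline : ∀ t : ℝ, (fun l => (ε l : ℝ) * (fun j => p j + t * ((u j : ℝ) / ∑ l, ((u l : ℝ)) ^ 2)) (σ l)) =
      fun l => (![θ₀ + t / 2 + κ 0 / 2, θ₀ + t / 2 - κ 0 / 2, κ 1] : Fin 3 → ℝ) l + 2 * π * L l := by
    intro t
    ext l
    simp only [hu2, huσ, mul_add]
    fin_cases l
    · simp [hκ, hθ₀, hp'', hp']; linear_combination (t * (1 / 2)) * hε2' 0
    · simp [hκ, hθ₀, hp'', hp']; linear_combination (t * (1 / 2)) * hε2' 1
    · simp [hκ, hp'', hp']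
  -- margins along the reduced line
  have hmargin : ∀ (t : ℝ) (L' : Fin 3 → ℤ),
      m ≤ ‖fun j => (![θ₀ + t / 2 + κ 0 / 2, θ₀ + t / 2 - κ 0 / 2, κ 1] : Fin 3 → ℝ) j - 2 * π * (L' j : ℝ)‖ := by
    intro t L'
    set Lo : Fin 3 → ℤ := fun i => ε (σ.symm i) * (L + L') (σ.symm i) with hLo
    have key : (fun j => (![θ₀ + t / 2 + κ 0 / 2, θ₀ + t / 2 - κ 0 / 2, κ 1] : Fin 3 → ℝ) j - 2 * π * (L' j : ℝ)) =
        fun l => (ε l : ℝ) * (fun j => p j + t * ((u j : ℝ) / ∑ l, ((u l : ℝ)) ^ 2) - 2 * π * (Lo j : ℝ)) (σ l) := by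
      ext l
      have h := congrFun (hline t) l
      simp only at h ⊢
      simp only [hLo, Equiv.symm_apply_apply, Pi.add_apply, Int.cast_mul, Int.cast_add, mul_sub, h]
      linear_combination (2 * π * ((L l : ℝ) + L' l)) * hε2' l
    rw [key]
    exact le_of_le_of_eq (hpm t Lo) (norm_signedPerm σ ε hε _).symm
  have hCline : ∀ θ : ℝ, 0 < 1 - ∑' x : Site 3, q x * Real.cos (phase 3 ![θ + κ 0 / 2, θ - κ 0 / 2, κ 1] x) ∧
      (1 - ∑' x : Site 3, q x * Real.cos (phase 3 ![θ + κ 0 / 2, θ - κ 0 / 2, κ 1] x))⁻¹ ≤ C := by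
    intro θ
    refine hC _ fun L' => ?_
    have h := hmargin (2 * (θ - θ₀)) L'
    have hv : (![θ₀ + 2 * (θ - θ₀) / 2 + κ 0 / 2, θ₀ + 2 * (θ - θ₀) / 2 - κ 0 / 2, κ 1] : Fin 3 → ℝ) =
        ![θ + κ 0 / 2, θ - κ 0 / 2, κ 1] := by
      ext j; fin_cases j <;> simp
    rwa [hv] at h
  -- `κ ≠ 0`
  have hκne : ∃ j, κ j ≠ 0 := by
    by_contra hcon
    push Not at hcon
    have h := hmargin (-(2 * θ₀)) 0
    have hv : (fun j => (![θ₀ + -(2 * θ₀) / 2 + κ 0 / 2, θ₀ + -(2 * θ₀) / 2 - κ 0 / 2, κ 1] : Fin 3 → ℝ) j -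
        2 * π * ((0 : Fin 3 → ℤ) j : ℝ)) = 0 := by
      ext j; fin_cases j
      · simp [hcon 0]; ring
      · simp [hcon 0]; ring
      · simp [hcon 1]
    rw [hv, norm_zero] at h
    linarith
  obtain ⟨j₁, hj₁⟩ := hκne
  have hgood : ∃ j, ∀ z : ℤ, κ j ≠ z * (2 * π) := ⟨j₁, good_of_reduced_le (hκle j₁) hj₁⟩
  -- ### the moments and the holomorphic extension
  obtain ⟨ν, hνfin, hν0, hν⟩ := lineMoments_of_reduced hq0 hqs hq1 hqev hqsym hP0 hPs hGreen hGpos hGev hGsym hT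
    hκle ⟨j₁, hj₁⟩
  set γ : ℝ → ℝ := fun θ => (1 - ∑' x : Site 3, q x * Real.cos (phase 3 ![θ + κ 0 / 2, θ - κ 0 / 2, κ 1] x))⁻¹
    with hγdef
  obtain ⟨hγpos, hγc⟩ := lineFun_pos_continuous hq0 hqs hq1 hP0 hPs hGreen hGpos hgood
  have hγc' : Continuous γ := hγc
  have hper : Function.Periodic γ (2 * π) := lineFun_periodic q κ
  have heven : ∀ θ, γ (-θ) = γ θ := fun θ => lineFun_neg hqev hqsym κ θ
  have hmom : ∀ n : ℕ, ∫ θ in (-π)..π, γ θ * Real.cos (n * θ) = ∫ x, x ^ n ∂ν := fun n => by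
    rw [← hν n]; exact intervalIntegral.integral_congr fun θ _ => mul_comm _ _
  -- the margin of the base angle: `p·u = 2θ₀ + 2π(L₀ + L₁)`
  have hpu' : ∑ j, p j * (u j : ℝ) = 2 * θ₀ + 2 * π * ((L 0 + L 1 : ℤ) : ℝ) := by
    rw [hpu]; simp only [hθ₀, hp'']; push_cast; ring
  have hd' : ∀ n : ℤ, d ≤ |2 * θ₀ + 2 * π * ((L 0 + L 1 : ℤ) : ℝ) - 2 * π * n| := fun n => by
    have := hpd n; rwa [hpu', mul_comm (2 * π) (n : ℝ), show (n : ℝ) * (2 * π) = 2 * π * n by ring] at this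
  have hdπ : d ≤ π := (dist_pi_int_of_dist_two_pi_int hd' (x := 0) (by rw [abs_zero]; linarith)).2
  have hm₀ : 0 < Real.sin (d / 4) := Real.sin_pos_of_pos_of_lt_pi (by linarith) (by linarith)
  have hsin : ∀ z : ℂ, ‖z‖ < 1 / 2 * d → Real.sin (d / 4) ≤ |Real.sin (θ₀ + z.re / 2)| := by
    intro z hz
    have hx : |z.re / 2| < d / 4 := by
      rw [abs_div, abs_two]; have := Complex.abs_re_le_norm z; linarith
    exact sin_le_abs_sin_of_forall_le (by linarith) (dist_pi_int_of_dist_two_pi_int hd' hx).1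
  obtain ⟨F, hFd, hFtr, hFbd⟩ := exists_holoExt_of_cos_moments hγc' hper heven hν0 hmom θ₀ hm₀ hsin
  refine ⟨F, hFd, fun s hs => ?_, fun z hz => (hFbd z hz).trans ?_⟩
  · -- the real trace
    have hreal : γ (θ₀ + s / 2) = (1 - ∑' x : Site 3, q x *
        Real.cos (phase 3 (fun j => p j + s * ((u j : ℝ) / ∑ l, ((u l : ℝ)) ^ 2)) x))⁻¹ := by
      simp only [hγdef]
      congr 2
      calc ∑' x : Site 3, q x * Real.cos (phase 3 ![θ₀ + s / 2 + κ 0 / 2, θ₀ + s / 2 - κ 0 / 2, κ 1] x)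
          = ∑' x : Site 3, q x * Real.cos (phase 3 (fun j =>
              (![θ₀ + s / 2 + κ 0 / 2, θ₀ + s / 2 - κ 0 / 2, κ 1] : Fin 3 → ℝ) j + 2 * π * L j) x) :=
            (symbol_add_int_mul_two_pi q _ L).symm
        _ = ∑' x : Site 3, q x * Real.cos (phase 3 (fun l => (ε l : ℝ) *
              (fun j => p j + s * ((u j : ℝ) / ∑ l, ((u l : ℝ)) ^ 2)) (σ l)) x) := by rw [hline s]
        _ = ∑' x : Site 3, q x * Real.cos (phase 3 (fun j => p j + s * ((u j : ℝ) / ∑ l, ((u l : ℝ)) ^ 2)) x) :=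
            symbol_signedPerm q σ ε hε (hqsp σ ε hε) (fun j => p j + s * ((u j : ℝ) / ∑ l, ((u l : ℝ)) ^ 2))
    rw [hFtr s hs, hreal]
  · -- the bound: `ν(ℝ) = ∫ γ ≤ 2π C`
    have hmass : ν.real Set.univ = ∫ θ in (-π)..π, γ θ := by
      have h := hν 0
      have h1 : (∫ θ in (-π)..π, Real.cos ((0 : ℕ) * θ) * γ θ) = ∫ θ in (-π)..π, γ θ :=
        intervalIntegral.integral_congr fun θ _ => by simp
      have h2 : ∫ x, x ^ (0 : ℕ) ∂ν = ν.real Set.univ := by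
        simp only [pow_zero, integral_const, smul_eq_mul, mul_one]
      rw [h1, h2] at h
      exact h.symm
    have hint : ∫ θ in (-π)..π, γ θ ≤ 2 * π * C := by
      calc ∫ θ in (-π)..π, γ θ ≤ ∫ θ in (-π)..π, C :=
            intervalIntegral.integral_mono_on (by linarith) (hγc'.intervalIntegrable _ _) intervalIntegrable_const
              fun θ _ => (hCline θ).2
        _ = 2 * π * C := by rw [intervalIntegral.integral_const, smul_eq_mul]; ring
    rw [hmass]
    have hden : 0 < 2 * π * Real.sin (d / 4) ^ 2 := by positivity
    exact div_le_div_of_nonneg_right hint hden.le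

end Summit.CriticalPhenomena.Ising3DConformalLimit.Cruxes.DirectCorrelationStableTail.SelfEnergyPickInversion

end
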